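import Mathlib
import Literature.Analysis.FunctionSpaces.TorusTrigPoly
import Literature.Analysis.FunctionSpaces.TorusFourierModes
import Literature.Analysis.FunctionSpaces.TorusDirichletKernel
import HarnessLib

/-!
# Route TaylorCertificates — `PacketLemma`, helper 6: the curl packet as a real trigonometric polynomial

Algebra of the packet in the proof of
`Summit.AnomalousDissipation.AnomalousDissipation.Theses.TaylorCertificates.PacketLemma`
(item stmt-AnomalousDissipation-14032). With an envelope `ψ = ∑_{k∈Ω_M} α_k e_k` (scalar
trigonometric polynomial over the cube `Ω_M = Torus.freqCube M`), a carrier `p ∈ ℤ³` and a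
direction `a ∈ ℝ³`, the packet is `w = ∇(Im(ψ e_p)) × a`, i.e. the real vector trigonometric
polynomial `realTrigPoly (Ω_M + p) c` with

  `c_m = 2π α_{m-p} (m × a)`     (complexified cross product with the lattice vector `m`).

* `isTransversal_packetCoeff` — `m · c_m = 0`, so the packet is divergence free
  (`Torus.isDivFree_realTrigPoly`);
* `integral_realTrigPoly`, `hasZeroMean_realTrigPoly` — mean zero off the zero mode;
* `fourierTruncate_realTrigPoly_eq_zero` / `_eq_self` — the truncations `P_N` of a real
  trigonometric polynomial whose frequencies (and their negatives) lie outside / inside the ball;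
* `trigPoly_packet_eq` — the **pointwise decomposition**
  `∑_{m∈Ω_M+p} e_m c_m = e_p (2π ψ · (p × a) + U)`, `U = ∑_{k∈Ω_M} e_k 2π α_k (k × a)`, whose real
  part is `w = 2π Re(e_p ψ) (p × a) + Re(e_p U)` (`realTrigPoly_packet_eq`);
* `integral_norm_sq_crossPoly_le` — `∫ ‖U‖² ≤ 12 π² M² ‖a‖² ∫ |ψ|²` (finite Parseval and
  `|k × a| ≤ |k| |a|`, `|k|² ≤ 3M²` on the cube).

The cross product is Mathlib's `crossProduct` on `Fin 3 → ℝ`, transported to `EuclideanSpace`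
through `WithLp.toLp/ofLp`, written out in full (no notation, no definitions, no named facts).
-/

noncomputable section

open MeasureTheory UnitAddTorus Complex Real
open scoped ComplexConjugate

namespace Summit.AnomalousDissipation.AnomalousDissipation.Theorems

-- the mandated namespace `Summit.<Summit>.<Problem>.Theorems` repeats `AnomalousDissipation` (single-problem summit)
set_option linter.dupNamespace false

open Literature.Analysis.FunctionSpaces Literature.Analysis.FunctionSpaces.Torus

/-! ### Cross products on `EuclideanSpace ℝ (Fin 3)` -/

/-- `⟪u, u × v⟫ = 0`. [folklore] -/
theorem inner_self_crossE (u v : EuclideanSpace ℝ (Fin 3)) : inner ℝ u ((WithLp.toLp 2 (crossProduct (WithLp.ofLp u) (WithLp.ofLp v)) : EuclideanSpace ℝ (Fin 3))) = 0 := by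
  rw [EuclideanSpace.inner_eq_star_dotProduct]
  simp [dotProduct_comm, dot_self_cross]

/-- `⟪v, u × v⟫ = 0`. [folklore] -/
theorem inner_crossE_self (u v : EuclideanSpace ℝ (Fin 3)) : inner ℝ v ((WithLp.toLp 2 (crossProduct (WithLp.ofLp u) (WithLp.ofLp v)) : EuclideanSpace ℝ (Fin 3))) = 0 := by
  rw [EuclideanSpace.inner_eq_star_dotProduct]
  simp [dotProduct_comm, dot_cross_self]

/-- Lagrange's identity: `‖u × v‖² = ‖u‖² ‖v‖² - ⟪u, v⟫²`. [folklore] -/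
theorem norm_crossE_sq (u v : EuclideanSpace ℝ (Fin 3)) :
    ‖(WithLp.toLp 2 (crossProduct (WithLp.ofLp u) (WithLp.ofLp v)) : EuclideanSpace ℝ (Fin 3))‖ ^ 2 = ‖u‖ ^ 2 * ‖v‖ ^ 2 - inner ℝ u v ^ 2 := by
  rw [← real_inner_self_eq_norm_sq, ← real_inner_self_eq_norm_sq, ← real_inner_self_eq_norm_sq]
  simp only [EuclideanSpace.inner_eq_star_dotProduct, star_trivial]
  rw [cross_dot_cross, dotProduct_comm (WithLp.ofLp v) (WithLp.ofLp u)]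
  ring

/-- `‖u × v‖ ≤ ‖u‖ ‖v‖`. [folklore] -/
theorem norm_crossE_le (u v : EuclideanSpace ℝ (Fin 3)) : ‖(WithLp.toLp 2 (crossProduct (WithLp.ofLp u) (WithLp.ofLp v)) : EuclideanSpace ℝ (Fin 3))‖ ≤ ‖u‖ * ‖v‖ := by
  have h := norm_crossE_sq u v
  have h1 : ‖(WithLp.toLp 2 (crossProduct (WithLp.ofLp u) (WithLp.ofLp v)) : EuclideanSpace ℝ (Fin 3))‖ ^ 2 ≤ (‖u‖ * ‖v‖) ^ 2 := by rw [h]; nlinarith [sq_nonneg (inner ℝ u v)]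
  exact (pow_le_pow_iff_left₀ (norm_nonneg _) (by positivity) two_ne_zero).1 h1

/-- The cross product is additive in the first slot. [folklore] -/
theorem add_crossE (u u' v : EuclideanSpace ℝ (Fin 3)) : (WithLp.toLp 2 (crossProduct (WithLp.ofLp (u + u')) (WithLp.ofLp v)) : EuclideanSpace ℝ (Fin 3)) = (WithLp.toLp 2 (crossProduct (WithLp.ofLp u) (WithLp.ofLp v)) : EuclideanSpace ℝ (Fin 3)) + (WithLp.toLp 2 (crossProduct (WithLp.ofLp u') (WithLp.ofLp v)) : EuclideanSpace ℝ (Fin 3)) := by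
  rw [WithLp.ofLp_add, LinearMap.map_add₂, WithLp.toLp_add]

/-! ### Real parts of complex multiples of real vectors -/

/-- `Re (z • complexify v) = (Re z) • v`. [folklore] -/
theorem realPart_smul_complexify {ι : Type*} [Fintype ι] (z : ℂ) (v : EuclideanSpace ℝ ι) :
    EuclideanSpace.realPart (z • EuclideanSpace.complexify v) = z.re • v := by
  ext i
  simp [EuclideanSpace.realPart_apply, EuclideanSpace.complexify_apply, Complex.mul_re]

/-- `‖Re (z • w)‖ ≤ ‖w‖` for `‖z‖ ≤ 1`. [folklore] -/
theorem norm_realPart_smul_le {ι : Type*} [Fintype ι] {z : ℂ} (hz : ‖z‖ ≤ 1) (w : EuclideanSpace ℂ ι) :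
    ‖EuclideanSpace.realPart (z • w)‖ ≤ ‖w‖ := by
  refine (EuclideanSpace.norm_realPart_le _).trans ?_
  rw [norm_smul]
  exact (mul_le_mul_of_nonneg_right hz (norm_nonneg _)).trans_eq (one_mul _)

/-! ### The packet coefficients: transversality, mean, truncations -/

/-- **The packet coefficients are transversal**: `∑ⱼ mⱼ (c_m)ⱼ = 0` for
`c_m = s_m • complexify (m × a)` (`m · (m × a) = 0`), on any frequency set. [folklore] -/
theorem isTransversal_packetCoeff (S : Finset (Fin 3 → ℤ)) (s : (Fin 3 → ℤ) → ℂ)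
    (a : EuclideanSpace ℝ (Fin 3)) (c : (Fin 3 → ℤ) → EuclideanSpace ℂ (Fin 3))
    (hc : ∀ m, c m = s m • EuclideanSpace.complexify ((WithLp.toLp 2 (crossProduct (WithLp.ofLp (latticeVec m)) (WithLp.ofLp a)) : EuclideanSpace ℝ (Fin 3)))) : IsTransversal S c := by
  intro m _
  have h := dot_self_cross (WithLp.ofLp (latticeVec m)) (WithLp.ofLp a)
  unfold dotProduct at h
  simp_rw [hc m, PiLp.smul_apply, EuclideanSpace.complexify_apply, smul_eq_mul]
  have h' : ∑ j, (m j : ℂ) * (s m * ((crossProduct (WithLp.ofLp (latticeVec m)) (WithLp.ofLp a) j : ℝ) : ℂ)) =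
      s m * ((∑ j, WithLp.ofLp (latticeVec m) j *
        crossProduct (WithLp.ofLp (latticeVec m)) (WithLp.ofLp a) j : ℝ) : ℂ) := by
    rw [Complex.ofReal_sum, Finset.mul_sum]
    refine Finset.sum_congr rfl fun j _ => ?_
    rw [Complex.ofReal_mul, latticeVec_apply, Complex.ofReal_intCast]
    ring
  rw [h', h]
  simp

/-- **Integral of a real trigonometric polynomial**: `∫ realTrigPoly S c = Re (𝟙_S(0) c 0)`. [folklore] -/
theorem integral_realTrigPoly (S : Finset (Fin 3 → ℤ)) (c : (Fin 3 → ℤ) → EuclideanSpace ℂ (Fin 3)) :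
    ∫ x, realTrigPoly S c x = EuclideanSpace.realPart (if (0 : Fin 3 → ℤ) ∈ S then c 0 else 0) := by
  simp_rw [realTrigPoly_apply]
  rw [ContinuousLinearMap.integral_comp_comm _ (continuous_trigPoly S c).integrable_unitAddTorus]
  congr 1
  simp_rw [trigPoly_apply]
  rw [integral_finsetSum S (f := fun k x => mFourier k x • c k)
    fun k _ => ((mFourier k).continuous.smul continuous_const).integrable_unitAddTorus]
  simp_rw [integral_smul_const, integral_mFourier, ite_smul, one_smul, zero_smul]
  rw [Finset.sum_ite_eq']

/-- A real trigonometric polynomial without the zero mode has zero mean. [folklore] -/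
theorem hasZeroMean_realTrigPoly {S : Finset (Fin 3 → ℤ)} (h0 : (0 : Fin 3 → ℤ) ∉ S)
    (c : (Fin 3 → ℤ) → EuclideanSpace ℂ (Fin 3)) : HasZeroMean (realTrigPoly S c) := by
  rw [HasZeroMean, integral_realTrigPoly, if_neg h0, map_zero]

/-- **Low truncations kill a high-frequency real trigonometric polynomial**: if every frequency of
`S` has `|k|² > N²` then `P_N (realTrigPoly S c) = 0`. [folklore] -/
theorem fourierTruncate_realTrigPoly_eq_zero {S : Finset (Fin 3 → ℤ)} {N : ℕ}
    (hS : ∀ k ∈ S, (N : ℝ) ^ 2 < freqNormSq k) (c : (Fin 3 → ℤ) → EuclideanSpace ℂ (Fin 3)) :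
    fourierTruncate N (realTrigPoly S c) = 0 := by
  rw [fourierTruncate_eq]
  rw [realTrigPoly_congr (c' := 0) fun k hk => ?_]
  · exact realTrigPoly_zero _
  have hk' := mem_freqBall.1 hk
  refine mFourierCoeff_realTrigPoly_eq_zero_of_not_mem c (fun h => ?_) (fun h => ?_)
  · exact absurd (hS k h) (not_lt.2 hk')
  · have := hS (-k) h
    rw [freqNormSq_neg] at this
    exact absurd this (not_lt.2 hk')

/-- **High truncations fix a band-limited real trigonometric polynomial**: if every frequency of
`S` has `|k|² ≤ N²` then `P_N (realTrigPoly S c) = realTrigPoly S c`. [folklore] -/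
theorem fourierTruncate_realTrigPoly_eq_self {S : Finset (Fin 3 → ℤ)} {N : ℕ}
    (hS : ∀ k ∈ S, freqNormSq k ≤ (N : ℝ) ^ 2) (c : (Fin 3 → ℤ) → EuclideanSpace ℂ (Fin 3)) :
    fourierTruncate N (realTrigPoly S c) = realTrigPoly S c := by
  refine fourierTruncate_eq_self (continuous_realTrigPoly S c) fun k hk => ?_
  refine mFourierCoeff_realTrigPoly_eq_zero_of_not_mem c (fun h => ?_) (fun h => ?_)
  · exact absurd (hS k h) (not_le.2 hk)
  · have := hS (-k) h
    rw [freqNormSq_neg] at this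
    exact absurd this (not_le.2 hk)

/-! ### The pointwise decomposition of the packet -/

/-- **The packet splits into its carrier part and a remainder**: with
`c_m = 2π α_{m-p} (m × a)` and `u_k = 2π α_k (k × a)`,
`∑_{m ∈ Ω_M + p} e_m(x) c_m = e_p(x) • (2π ψ(x) • (p × a) + ∑_{k∈Ω_M} e_k(x) u_k)`,
`ψ = ∑_{k∈Ω_M} α_k e_k`. [folklore] -/
theorem trigPoly_packet_eq (M : ℕ) (p : Fin 3 → ℤ) (a : EuclideanSpace ℝ (Fin 3))
    (α : (Fin 3 → ℤ) → ℂ) (c u : (Fin 3 → ℤ) → EuclideanSpace ℂ (Fin 3))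
    (hc : ∀ m, c m = ((2 * π : ℂ) * α (m - p)) • EuclideanSpace.complexify ((WithLp.toLp 2 (crossProduct (WithLp.ofLp (latticeVec m)) (WithLp.ofLp a)) : EuclideanSpace ℝ (Fin 3))))
    (hu : ∀ k, u k = ((2 * π : ℂ) * α k) • EuclideanSpace.complexify ((WithLp.toLp 2 (crossProduct (WithLp.ofLp (latticeVec k)) (WithLp.ofLp a)) : EuclideanSpace ℝ (Fin 3))))
    (x : UnitAddTorus (Fin 3)) :
    trigPoly ((freqCube M).image (· + p)) c x =
      mFourier p x • (((2 * π : ℂ) * trigPoly (freqCube M) α x) •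
        EuclideanSpace.complexify ((WithLp.toLp 2 (crossProduct (WithLp.ofLp (latticeVec p)) (WithLp.ofLp a)) : EuclideanSpace ℝ (Fin 3))) + trigPoly (freqCube M) u x) := by
  rw [trigPoly_apply, Finset.sum_image fun k _ l _ h => add_right_cancel h, trigPoly_apply,
    trigPoly_apply, Finset.mul_sum, Finset.sum_smul, ← Finset.sum_add_distrib, Finset.smul_sum]
  refine Finset.sum_congr rfl fun k _ => ?_
  rw [hc, hu, add_sub_cancel_right, latticeVec_add, add_crossE, map_add, mFourier_add]
  simp only [smul_add, smul_smul, smul_eq_mul]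
  rw [add_comm]
  congr 1
  · congr 1; ring
  · congr 1; ring

/-- **Real form of the decomposition**: the packet `w = realTrigPoly (Ω_M + p) c` is
`w(x) = (2π Re(e_p(x) ψ(x))) • (p × a) + Re (e_p(x) • U(x))`, `U = ∑_{k∈Ω_M} e_k u_k`. [folklore] -/
theorem realTrigPoly_packet_eq (M : ℕ) (p : Fin 3 → ℤ) (a : EuclideanSpace ℝ (Fin 3))
    (α : (Fin 3 → ℤ) → ℂ) (c u : (Fin 3 → ℤ) → EuclideanSpace ℂ (Fin 3))
    (hc : ∀ m, c m = ((2 * π : ℂ) * α (m - p)) • EuclideanSpace.complexify ((WithLp.toLp 2 (crossProduct (WithLp.ofLp (latticeVec m)) (WithLp.ofLp a)) : EuclideanSpace ℝ (Fin 3))))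
    (hu : ∀ k, u k = ((2 * π : ℂ) * α k) • EuclideanSpace.complexify ((WithLp.toLp 2 (crossProduct (WithLp.ofLp (latticeVec k)) (WithLp.ofLp a)) : EuclideanSpace ℝ (Fin 3))))
    (x : UnitAddTorus (Fin 3)) :
    realTrigPoly ((freqCube M).image (· + p)) c x =
      (2 * π * (mFourier p x * trigPoly (freqCube M) α x).re) • ((WithLp.toLp 2 (crossProduct (WithLp.ofLp (latticeVec p)) (WithLp.ofLp a)) : EuclideanSpace ℝ (Fin 3))) +
        EuclideanSpace.realPart (mFourier p x • trigPoly (freqCube M) u x) := by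
  rw [realTrigPoly_apply, trigPoly_packet_eq M p a α c u hc hu x, smul_add, map_add, smul_smul,
    realPart_smul_complexify]
  congr 2
  rw [show (mFourier p x * ((2 * π : ℂ) * trigPoly (freqCube M) α x)) =
    ((2 * π : ℝ) : ℂ) * (mFourier p x * trigPoly (freqCube M) α x) by push_cast; ring,
    Complex.re_ofReal_mul]

/-! ### The size of the remainder -/

/-- On the cube, `|k|² ≤ 3 M²`. [folklore] -/
theorem norm_latticeVec_sq_le {M : ℕ} {k : Fin 3 → ℤ} (hk : k ∈ freqCube M) :
    ‖latticeVec k‖ ^ 2 ≤ 3 * (M : ℝ) ^ 2 := by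
  rw [EuclideanSpace.norm_sq_eq, Fin.sum_univ_three]
  simp only [latticeVec_apply, Real.norm_eq_abs, sq_abs]
  have h := mem_freqCube.1 hk
  have h0 := h 0; have h1 := h 1; have h2 := h 2
  have e0 : ((k 0 : ℝ)) ^ 2 ≤ (M : ℝ) ^ 2 := by
    rw [sq_le_sq, abs_le]; exact ⟨by rw [Nat.abs_cast]; exact_mod_cast h0.1, by rw [Nat.abs_cast]; exact_mod_cast h0.2⟩
  have e1 : ((k 1 : ℝ)) ^ 2 ≤ (M : ℝ) ^ 2 := by
    rw [sq_le_sq, abs_le]; exact ⟨by rw [Nat.abs_cast]; exact_mod_cast h1.1, by rw [Nat.abs_cast]; exact_mod_cast h1.2⟩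
  have e2 : ((k 2 : ℝ)) ^ 2 ≤ (M : ℝ) ^ 2 := by
    rw [sq_le_sq, abs_le]; exact ⟨by rw [Nat.abs_cast]; exact_mod_cast h2.1, by rw [Nat.abs_cast]; exact_mod_cast h2.2⟩
  linarith

/-- **The remainder is small in `L²`**: with `u_k = 2π α_k (k × a)`,
`∫ ‖∑_{k∈Ω_M} e_k u_k‖² ≤ 12 π² M² ‖a‖² ∫ |∑_{k∈Ω_M} e_k α_k|²` (finite Parseval on both sides). [folklore] -/
theorem integral_norm_sq_crossPoly_le (M : ℕ) (a : EuclideanSpace ℝ (Fin 3))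
    (α : (Fin 3 → ℤ) → ℂ) (u : (Fin 3 → ℤ) → EuclideanSpace ℂ (Fin 3))
    (hu : ∀ k, u k = ((2 * π : ℂ) * α k) • EuclideanSpace.complexify ((WithLp.toLp 2 (crossProduct (WithLp.ofLp (latticeVec k)) (WithLp.ofLp a)) : EuclideanSpace ℝ (Fin 3)))) :
    ∫ x, ‖trigPoly (freqCube M) u x‖ ^ 2 ≤
      12 * π ^ 2 * M ^ 2 * ‖a‖ ^ 2 * ∫ x, ‖trigPoly (freqCube M) α x‖ ^ 2 := by
  rw [integral_norm_sq_trigPoly, integral_norm_sq_trigPoly, Finset.mul_sum]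
  refine Finset.sum_le_sum fun k hk => ?_
  rw [hu, norm_smul, EuclideanSpace.norm_complexify, mul_pow, norm_mul, mul_pow,
    show ‖(2 * π : ℂ)‖ = 2 * π by
      rw [show (2 * π : ℂ) = ((2 * π : ℝ) : ℂ) by push_cast; ring, Complex.norm_real,
        Real.norm_eq_abs, abs_of_pos Real.two_pi_pos]]
  have h1 : ‖(WithLp.toLp 2 (crossProduct (WithLp.ofLp (latticeVec k)) (WithLp.ofLp a)) : EuclideanSpace ℝ (Fin 3))‖ ^ 2 ≤ 3 * (M : ℝ) ^ 2 * ‖a‖ ^ 2 := by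
    refine (pow_le_pow_left₀ (norm_nonneg _) (norm_crossE_le _ _) 2).trans ?_
    rw [mul_pow]
    exact mul_le_mul_of_nonneg_right (norm_latticeVec_sq_le hk) (sq_nonneg _)
  have h2 : 0 ≤ (2 * π) ^ 2 * ‖α k‖ ^ 2 := by positivity
  calc (2 * π) ^ 2 * ‖α k‖ ^ 2 * ‖(WithLp.toLp 2 (crossProduct (WithLp.ofLp (latticeVec k)) (WithLp.ofLp a)) : EuclideanSpace ℝ (Fin 3))‖ ^ 2
      ≤ (2 * π) ^ 2 * ‖α k‖ ^ 2 * (3 * (M : ℝ) ^ 2 * ‖a‖ ^ 2) := mul_le_mul_of_nonneg_left h1 h2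
    _ = 12 * π ^ 2 * M ^ 2 * ‖a‖ ^ 2 * ‖α k‖ ^ 2 := by ring

end Summit.AnomalousDissipation.AnomalousDissipation.Theorems
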